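import Summits.FinalStateConjecture.FinalStateConjecture.Theorems.StarvedNecksNecksCertifyStubSeamSurgeryHelpers

/-!
# Route StarvedNecks — crux `NecksCertify`, line `two-cap-focusing-ledger`: stub CS
# (cone separation from distinct velocities)

Stub `stub_coneSeparation` of the lead's skeleton (registered signature, verbatim): for a
final-state decomposition `d` (any spacetime, any `k`) whose motions `(Λᵢ, cᵢ)` are orthochronous
(`(Λᵢ∂₀)⁰ > 0`) with pairwise distinct asymptotic four-velocities `Λᵢ∂₀ ≠ Λⱼ∂₀`, there are a slope
`c > 0` and a flat time `τc` such that for all `i ≠ j` and all `y : E4` with `τc ≤ y⁰`: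
`rᵢ(y) ≤ c·y⁰ ⇒ c·y⁰ < rⱼ(y)`, where `rᵢ(y) = r_{aᵢ}(Λᵢ⁻¹(y − cᵢ))` is the boosted Kerr–Schild
radius of hole `i` (`(d.background i).radius y`).

Proof (Euclidean kinematics on `E4`; no physics).  Write `uᵢ := Λᵢ∂₀`, `γᵢ := uᵢ⁰ ≥ 1`, and
`Cᵢ := ‖Λᵢ‖(1 + ‖Λᵢ‖)` (operator norm on Euclidean `E4`).

* §1 `norm_sub_axisPoint_le`: the axis `cᵢ + ℝuᵢ` of hole `i` crosses the slice `{x⁰ = y⁰}` at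
  `pᵢ(y⁰) := cᵢ + ((y⁰ − cᵢ⁰)/γᵢ)·uᵢ`, and `‖y − pᵢ(y⁰)‖ ≤ Cᵢ‖z⃗‖` for the rest-frame coordinates
  `z := Λᵢ⁻¹(y − cᵢ)` (decompose `z = z⁰∂₀ + z⃗`, so `y − cᵢ = z⁰uᵢ + Λᵢz⃗`, and correct the clock
  along `uᵢ` by `(Λᵢz⃗)⁰/γᵢ`).  With `‖z⃗‖ ≤ rᵢ(y) + |aᵢ|`
  (`Seam.spatialNorm_le_kerr_radius_add_abs`) this reads `‖y − pᵢ(y⁰)‖ ≤ Cᵢ(rᵢ(y) + |aᵢ|)` —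
  used for `i` (upper bound) AND for `j` (lower bound on `rⱼ`).
* §2 `le_norm_axisPoint_sub_axisPoint`: `pᵢ(s) − pⱼ(s) = s·w + e` with `w := uᵢ/γᵢ − uⱼ/γⱼ`, hence
  `‖pᵢ(s) − pⱼ(s)‖ ≥ s‖w‖ − ‖e‖` for `s ≥ 0`; and `w ≠ 0` (`inv_smul_lorentz_sub_ne_zero`: `uᵢ, uⱼ`
  are `η`-unit with positive time components, so `uᵢ/γᵢ = uⱼ/γⱼ` forces `γᵢ = γⱼ`, `uᵢ = uⱼ`).
* §3 `cone_pair`: for ONE ordered pair every slope `0 < κ ≤ ‖w‖/(2(Cᵢ + Cⱼ + 1))` works after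
  `τ₀ := 2(‖e‖ + Cᵢ|aᵢ| + Cⱼ|aⱼ|)/‖w‖ + 1` (triangle inequality through `y`).
* §4 the stub: the minimum of the pair slopes and the maximum of the pair times over the finitely
  many ordered pairs (`Finite.exists_le` on `Fin d.N × Fin d.N`; vacuous for `d.N ≤ 1`).

Mathlib + the landed helper module `StarvedNecksNecksCertifyStubSeamSurgeryHelpers`
(`one_le_lorentz_time`, `spatialNorm_le_kerr_radius_add_abs`); no definitions, no named facts.
-/

noncomputable section

open scoped Manifold ContDiff Topology ENNReal
open Filter Set MeasureTheory Topology Literature.Geometry.Lorentzian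

namespace Summit.FinalStateConjecture.FinalStateConjecture.Theorems.NecksCertifyTwoCap.Cones

open Summit.FinalStateConjecture.FinalStateConjecture.Theorems.NecksCertifyBargmann.Seam

set_option linter.dupNamespace false

/-! ## §1 Distance from an event to the simultaneous axis point of a hole -/

/-- `‖z − z⁰∂₀‖ = ‖z⃗‖`: the Euclidean norm of the spatial part of `z ∈ E4` is its spatial
radius. -/
theorem norm_sub_smul_basisVector_zero (z : E4) :
    ‖z - z 0 • E4.basisVector 0‖ = E4.spatialNorm z := by
  have h : ‖z - z 0 • E4.basisVector 0‖ ^ 2 = E4.spatialNorm z ^ 2 := by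
    rw [EuclideanSpace.real_norm_sq_eq, E4.spatialNorm_sq, Fin.sum_univ_four]
    simp [Fin.ext_iff]
  exact (pow_left_inj₀ (norm_nonneg _) (E4.spatialNorm_nonneg _) two_ne_zero).1 h

section Lorentz

variable (Λ : lorentzGroup)

/-- `‖Λ∂₀‖ ≤ ‖Λ‖` for the operator norm of `Λ` on Euclidean `E4` (`‖∂₀‖ = 1`). -/
theorem norm_lorentz_basisVector_zero_le :
    ‖(Λ : E4 ≃L[ℝ] E4) (E4.basisVector 0)‖ ≤ ‖((Λ : E4 ≃L[ℝ] E4) : E4 →L[ℝ] E4)‖ := by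
  have h := ((Λ : E4 ≃L[ℝ] E4) : E4 →L[ℝ] E4).le_opNorm (E4.basisVector 0)
  rw [PiLp.norm_single, norm_one, mul_one] at h
  exact h

/-- **Distance to the simultaneous axis point.**  For a motion `(Λ, c)` with `u := Λ∂₀`,
`γ := u⁰ > 0`, and an event `y`, the point `p := c + ((y⁰ − c⁰)/γ)·u` of the axis `c + ℝu` (the one
with `p⁰ = y⁰`) satisfies `‖y − p‖ ≤ ‖Λ‖(1 + ‖Λ‖)·‖z⃗‖`, where `z := Λ⁻¹(y − c)` are the rest-frame
coordinates of `y`: indeed `y − c = z⁰u + Λz⃗` and `y − p = Λz⃗ − ((Λz⃗)⁰/γ)·u`. -/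
theorem norm_sub_axisPoint_le {u : E4} {γ : ℝ} (hu : u = (Λ : E4 ≃L[ℝ] E4) (E4.basisVector 0))
    (hγ : γ = u 0) (h : 0 < ((Λ : E4 ≃L[ℝ] E4) (E4.basisVector 0)) 0) (c y : E4) :
    ‖y - (c + ((y 0 - c 0) / γ) • u)‖ ≤
      ‖((Λ : E4 ≃L[ℝ] E4) : E4 →L[ℝ] E4)‖ * (1 + ‖((Λ : E4 ≃L[ℝ] E4) : E4 →L[ℝ] E4)‖) *
        E4.spatialNorm (poincareInv Λ c y) := by
  obtain ⟨L, hL⟩ : ∃ L : E4 ≃L[ℝ] E4, L = (Λ : E4 ≃L[ℝ] E4) := ⟨_, rfl⟩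
  obtain ⟨z, hz⟩ : ∃ z : E4, z = poincareInv Λ c y := ⟨_, rfl⟩
  obtain ⟨zs, hzs⟩ : ∃ zs : E4, zs = z - z 0 • E4.basisVector 0 := ⟨_, rfl⟩
  rw [← hL] at hu
  rw [← hL, ← hz]
  have hγ1 : 1 ≤ γ := by
    rw [hγ, hu, hL]
    exact one_le_lorentz_time Λ h
  have hγ0 : 0 < γ := by linarith
  -- `y − c = z⁰ u + Λ z⃗`
  have hyc : y - c = z 0 • u + L zs := by
    have h1 : y - c = L z := by
      rw [hz, poincareInv, ← hL, ContinuousLinearEquiv.apply_symm_apply]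
    rw [h1, hzs, map_sub, ContinuousLinearEquiv.map_smul, hu]
    abel
  -- its time component
  have hy0 : y 0 - c 0 = z 0 * γ + (L zs) 0 := by
    have h1 := congrArg (fun v : E4 ↦ v 0) hyc
    simp only [PiLp.sub_apply, PiLp.add_apply, PiLp.smul_apply, smul_eq_mul] at h1
    rw [h1, hγ]
  -- `y − p = Λ z⃗ − ((Λ z⃗)⁰ / γ) u`
  have key : y - (c + ((y 0 - c 0) / γ) • u) = L zs - ((L zs) 0 / γ) • u := by
    have h2 : (y 0 - c 0) / γ = z 0 + (L zs) 0 / γ := by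
      rw [hy0, add_div, mul_div_cancel_right₀ _ hγ0.ne']
    rw [← sub_sub, hyc, h2, add_smul]
    abel
  rw [key]
  have hzs_norm : ‖zs‖ = E4.spatialNorm z := by
    rw [hzs]
    exact norm_sub_smul_basisVector_zero z
  have hLzs : ‖L zs‖ ≤ ‖(L : E4 →L[ℝ] E4)‖ * ‖zs‖ := (L : E4 →L[ℝ] E4).le_opNorm zs
  have h0 : |(L zs) 0| ≤ ‖L zs‖ := by
    have h3 := PiLp.norm_apply_le (L zs) 0
    rwa [Real.norm_eq_abs] at h3
  have hu_norm : ‖u‖ ≤ ‖(L : E4 →L[ℝ] E4)‖ := by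
    rw [hu, hL]
    exact norm_lorentz_basisVector_zero_le Λ
  have hN : 0 ≤ ‖(L : E4 →L[ℝ] E4)‖ := norm_nonneg _
  have h4 : ‖((L zs) 0 / γ) • u‖ = |(L zs) 0| / γ * ‖u‖ := by
    rw [norm_smul, Real.norm_eq_abs, abs_div, abs_of_pos hγ0]
  have h5 : |(L zs) 0| / γ ≤ |(L zs) 0| := div_le_self (abs_nonneg _) hγ1
  have h6 : |(L zs) 0| / γ * ‖u‖ ≤ (‖(L : E4 →L[ℝ] E4)‖ * ‖zs‖) * ‖(L : E4 →L[ℝ] E4)‖ :=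
    mul_le_mul (h5.trans (h0.trans hLzs)) hu_norm (norm_nonneg _) (by positivity)
  calc ‖L zs - ((L zs) 0 / γ) • u‖
      ≤ ‖L zs‖ + ‖((L zs) 0 / γ) • u‖ := norm_sub_le _ _
    _ ≤ ‖(L : E4 →L[ℝ] E4)‖ * ‖zs‖ + (‖(L : E4 →L[ℝ] E4)‖ * ‖zs‖) * ‖(L : E4 →L[ℝ] E4)‖ := by
        rw [h4]
        exact add_le_add hLzs h6
    _ = ‖(L : E4 →L[ℝ] E4)‖ * (1 + ‖(L : E4 →L[ℝ] E4)‖) * E4.spatialNorm z := by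
        rw [hzs_norm]
        ring

/-! ## §2 Simultaneous axis points of two holes drift apart linearly -/

/-- **Distinct four-velocities are not positively proportional.**  For `Λ, Λ' ∈ O(1,3)` with
`u := Λ∂₀ ≠ u' := Λ'∂₀` and any `γ, γ' > 0`: `u/γ ≠ u'/γ'` (both are `η`-unit,
`η(u,u) = η(u',u') = −1`, so `γ'u = γu'` forces `γ = γ'` and then `u = u'`).  With `γ = u⁰`,
`γ' = u'⁰` this is "distinct four-velocities ⇒ distinct three-velocities". -/
theorem inv_smul_lorentz_sub_ne_zero (Λ' : lorentzGroup) {u u' : E4} {γ γ' : ℝ}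
    (hu : u = (Λ : E4 ≃L[ℝ] E4) (E4.basisVector 0))
    (hu' : u' = (Λ' : E4 ≃L[ℝ] E4) (E4.basisVector 0))
    (h : 0 < γ) (h' : 0 < γ') (hne : u ≠ u') : γ⁻¹ • u - γ'⁻¹ • u' ≠ 0 := by
  intro h0
  have h1 : γ' • u = γ • u' := by
    have h2 : γ⁻¹ • u = γ'⁻¹ • u' := sub_eq_zero.1 h0
    have h3 := congrArg (fun v : E4 ↦ (γ * γ') • v) h2
    simp only [smul_smul] at h3
    rwa [show γ * γ' * γ⁻¹ = γ' by field_simp, show γ * γ' * γ'⁻¹ = γ by field_simp] at h3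
  have hη : Minkowski.bilin u u = -1 := by
    rw [hu]
    exact (Λ.2 _ _).trans Minkowski.bilin_basisVector_zero
  have hη' : Minkowski.bilin u' u' = -1 := by
    rw [hu']
    exact (Λ'.2 _ _).trans Minkowski.bilin_basisVector_zero
  have h4 : Minkowski.bilin (γ' • u) (γ' • u) = Minkowski.bilin (γ • u') (γ • u') := by rw [h1]
  simp only [map_smul, _root_.smul_apply, smul_eq_mul, hη, hη'] at h4
  have h5 : (γ' - γ) * (γ' + γ) = 0 := by linear_combination -h4
  rcases mul_eq_zero.1 h5 with h6 | h6
  · rw [sub_eq_zero.1 h6] at h1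
    exact hne (smul_right_injective E4 h.ne' h1)
  · linarith

end Lorentz

/-- **Linear drift of the simultaneous axis points.**  With `p(s) := c + ((s − c⁰)/γ)·u` and
`p'(s) := c' + ((s − c'⁰)/γ')·u'` one has `p(s) − p'(s) = s·(u/γ − u'/γ') + e` with
`e := (c − (c⁰/γ)u) − (c' − (c'⁰/γ')u')`, hence `‖p(s) − p'(s)‖ ≥ s·‖u/γ − u'/γ'‖ − ‖e‖` for
`s ≥ 0`. -/
theorem le_norm_axisPoint_sub_axisPoint (c c' u u' : E4) (γ γ' s : ℝ) (hs : 0 ≤ s) :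
    s * ‖γ⁻¹ • u - γ'⁻¹ • u'‖ - ‖(c - (c 0 / γ) • u) - (c' - (c' 0 / γ') • u')‖ ≤
      ‖(c + ((s - c 0) / γ) • u) - (c' + ((s - c' 0) / γ') • u')‖ := by
  have key : (c + ((s - c 0) / γ) • u) - (c' + ((s - c' 0) / γ') • u') =
      s • (γ⁻¹ • u - γ'⁻¹ • u') + ((c - (c 0 / γ) • u) - (c' - (c' 0 / γ') • u')) := by
    module
  rw [key]
  have h1 : ‖s • (γ⁻¹ • u - γ'⁻¹ • u')‖ = s * ‖γ⁻¹ • u - γ'⁻¹ • u'‖ := by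
    rw [norm_smul, Real.norm_eq_abs, abs_of_nonneg hs]
  have h2 := norm_sub_le
    (s • (γ⁻¹ • u - γ'⁻¹ • u') + ((c - (c 0 / γ) • u) - (c' - (c' 0 / γ') • u')))
    ((c - (c 0 / γ) • u) - (c' - (c' 0 / γ') • u'))
  rw [add_sub_cancel_right, h1] at h2
  linarith

/-! ## §3 One ordered pair of holes -/

/-- **Cone separation for one ordered pair.**  For orthochronous motions `(Λ, c)`, `(Λ', c')` with
`Λ∂₀ ≠ Λ'∂₀` and spins `a, a'` there are `c₀ > 0` and `τ₀` such that for every slope `0 < κ ≤ c₀`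
and every event `y` with `τ₀ ≤ y⁰`: `r_a(Λ⁻¹(y − c)) ≤ κ·y⁰ ⇒ κ·y⁰ < r_{a'}(Λ'⁻¹(y − c'))`.
Constants: `c₀ := ‖w‖/(2(C + C' + 1))`, `τ₀ := 2(‖e‖ + C|a| + C'|a'|)/‖w‖ + 1` in the notation of
§1–§2. -/
theorem cone_pair (Λ Λ' : lorentzGroup) (c c' : E4) (a a' : ℝ)
    (h : 0 < ((Λ : E4 ≃L[ℝ] E4) (E4.basisVector 0)) 0)
    (h' : 0 < ((Λ' : E4 ≃L[ℝ] E4) (E4.basisVector 0)) 0)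
    (hne : (Λ : E4 ≃L[ℝ] E4) (E4.basisVector 0) ≠ (Λ' : E4 ≃L[ℝ] E4) (E4.basisVector 0)) :
    ∃ c₀ : ℝ, 0 < c₀ ∧ ∃ τ₀ : ℝ, ∀ κ : ℝ, 0 < κ → κ ≤ c₀ → ∀ y : E4, τ₀ ≤ y 0 →
      Kerr.radius a (poincareInv Λ c y) ≤ κ * y 0 →
        κ * y 0 < Kerr.radius a' (poincareInv Λ' c' y) := by
  obtain ⟨u, hu⟩ : ∃ u : E4, u = (Λ : E4 ≃L[ℝ] E4) (E4.basisVector 0) := ⟨_, rfl⟩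
  obtain ⟨u', hu'⟩ : ∃ u' : E4, u' = (Λ' : E4 ≃L[ℝ] E4) (E4.basisVector 0) := ⟨_, rfl⟩
  obtain ⟨γ, hγ⟩ : ∃ γ : ℝ, γ = u 0 := ⟨_, rfl⟩
  obtain ⟨γ', hγ'⟩ : ∃ γ' : ℝ, γ' = u' 0 := ⟨_, rfl⟩
  have hγp : 0 < γ := by rw [hγ, hu]; exact h
  have hγp' : 0 < γ' := by rw [hγ', hu']; exact h'
  obtain ⟨C, hC⟩ : ∃ C : ℝ,
      C = ‖((Λ : E4 ≃L[ℝ] E4) : E4 →L[ℝ] E4)‖ * (1 + ‖((Λ : E4 ≃L[ℝ] E4) : E4 →L[ℝ] E4)‖) :=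
    ⟨_, rfl⟩
  obtain ⟨C', hC'⟩ : ∃ C' : ℝ,
      C' = ‖((Λ' : E4 ≃L[ℝ] E4) : E4 →L[ℝ] E4)‖ * (1 + ‖((Λ' : E4 ≃L[ℝ] E4) : E4 →L[ℝ] E4)‖) :=
    ⟨_, rfl⟩
  have hC0 : 0 ≤ C := by rw [hC]; positivity
  have hC0' : 0 ≤ C' := by rw [hC']; positivity
  obtain ⟨w, hw⟩ : ∃ w : E4, w = γ⁻¹ • u - γ'⁻¹ • u' := ⟨_, rfl⟩
  obtain ⟨e, he⟩ : ∃ e : E4, e = (c - (c 0 / γ) • u) - (c' - (c' 0 / γ') • u') := ⟨_, rfl⟩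
  have hw0 : w ≠ 0 := by
    rw [hw]
    exact inv_smul_lorentz_sub_ne_zero Λ Λ' hu hu' hγp hγp' (by rwa [hu, hu'])
  have hwp : 0 < ‖w‖ := norm_pos_iff.2 hw0
  obtain ⟨K, hK⟩ : ∃ K : ℝ, K = ‖e‖ + C * |a| + C' * |a'| := ⟨_, rfl⟩
  have hK0 : 0 ≤ K := by rw [hK]; positivity
  refine ⟨‖w‖ / (2 * (C + C' + 1)), div_pos hwp (by positivity), 2 * K / ‖w‖ + 1, ?_⟩
  intro κ hκ hκc y hy hri
  have hs0 : 0 ≤ y 0 := by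
    have : 0 ≤ 2 * K / ‖w‖ := by positivity
    linarith
  have hsw : 2 * K + ‖w‖ ≤ y 0 * ‖w‖ := by
    have h1 := mul_le_mul_of_nonneg_right hy hwp.le
    rwa [add_mul, one_mul, div_mul_cancel₀ _ hwp.ne'] at h1
  have hκ' : κ * (C + C' + 1) ≤ ‖w‖ / 2 := by
    rw [le_div_iff₀ (by positivity)] at hκc
    linarith
  have hκs : κ * (C + C' + 1) * y 0 ≤ ‖w‖ / 2 * y 0 := mul_le_mul_of_nonneg_right hκ' hs0
  have hκy : 0 < κ * y 0 := mul_pos hκ (by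
    have : 0 ≤ 2 * K / ‖w‖ := by positivity
    linarith)
  -- the simultaneous axis points of the two holes
  obtain ⟨p, hp⟩ : ∃ p : E4, p = c + ((y 0 - c 0) / γ) • u := ⟨_, rfl⟩
  obtain ⟨p', hp'⟩ : ∃ p' : E4, p' = c' + ((y 0 - c' 0) / γ') • u' := ⟨_, rfl⟩
  have hAi : ‖y - p‖ ≤ C * E4.spatialNorm (poincareInv Λ c y) := by
    rw [hp, hC]
    exact norm_sub_axisPoint_le Λ hu hγ h c y
  have hAj : ‖y - p'‖ ≤ C' * E4.spatialNorm (poincareInv Λ' c' y) := by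
    rw [hp', hC']
    exact norm_sub_axisPoint_le Λ' hu' hγ' h' c' y
  have hB : y 0 * ‖w‖ - ‖e‖ ≤ ‖p - p'‖ := by
    rw [hp, hp', hw, he]
    exact le_norm_axisPoint_sub_axisPoint c c' u u' γ γ' (y 0) hs0
  have htri : ‖p - p'‖ ≤ ‖y - p‖ + ‖y - p'‖ := by
    have h1 := norm_sub_le (y - p') (y - p)
    rw [sub_sub_sub_cancel_left] at h1
    linarith
  have hδi : E4.spatialNorm (poincareInv Λ c y) ≤ Kerr.radius a (poincareInv Λ c y) + |a| :=
    spatialNorm_le_kerr_radius_add_abs a _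
  have hδj : E4.spatialNorm (poincareInv Λ' c' y) ≤ Kerr.radius a' (poincareInv Λ' c' y) + |a'| :=
    spatialNorm_le_kerr_radius_add_abs a' _
  by_contra hlt
  have hrj : Kerr.radius a' (poincareInv Λ' c' y) ≤ κ * y 0 := not_lt.1 hlt
  have h1 : C * E4.spatialNorm (poincareInv Λ c y) ≤ C * (κ * y 0 + |a|) :=
    mul_le_mul_of_nonneg_left (by linarith) hC0
  have h2 : C' * E4.spatialNorm (poincareInv Λ' c' y) ≤ C' * (κ * y 0 + |a'|) :=
    mul_le_mul_of_nonneg_left (by linarith) hC0'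
  have h3 : y 0 * ‖w‖ - ‖e‖ ≤ C * (κ * y 0 + |a|) + C' * (κ * y 0 + |a'|) := by linarith
  have h4 : C * (κ * y 0 + |a|) + C' * (κ * y 0 + |a'|) ≤
      ‖w‖ / 2 * y 0 - κ * y 0 + C * |a| + C' * |a'| := by linarith
  linarith

/-! ## §4 The registered stub -/

/-- **Registered stub CS — cone separation from distinct velocities.**  For every final-state
decomposition `d` (any `k`, any spacetime) with orthochronous motions (`(Λᵢ∂₀)⁰ > 0`) and pairwise
distinct `Λᵢ∂₀`, there are `c > 0` and `τc` with: for all `i ≠ j` and `y : E4` with `τc ≤ y⁰`,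
`rᵢ(y) ≤ c·y⁰ ⇒ c·y⁰ < rⱼ(y)` (`rᵢ = (d.background i).radius`, the boosted Kerr–Schild radius).
Proof: `cone_pair` for each ordered pair, then the minimum slope / maximum time over the finitely
many pairs. -/
theorem stub_coneSeparation :
  ∀ (𝓢 : Spacetime.{0} 4) (O : Set 𝓢.carrier) (k : ℕ) (d : FinalStateDecomposition 𝓢 O k),
    (∀ i, 0 < ((d.motion i).1 : E4 ≃L[ℝ] E4) (E4.basisVector 0) 0) →
    (∀ i j : Fin d.N, i ≠ j →
      ((d.motion i).1 : E4 ≃L[ℝ] E4) (E4.basisVector 0) ≠ ((d.motion j).1 : E4 ≃L[ℝ] E4) (E4.basisVector 0)) →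
    ∃ c : ℝ, 0 < c ∧ ∃ τc : ℝ, ∀ (i j : Fin d.N) (y : E4), i ≠ j → τc ≤ y 0 →
      (d.background i).radius y ≤ c * y 0 → c * y 0 < (d.background j).radius y := by
  intro 𝓢 O k d horth hdv
  have hpair : ∀ p : Fin d.N × Fin d.N, ∃ c₀ : ℝ, 0 < c₀ ∧ ∃ τ₀ : ℝ, p.1 ≠ p.2 →
      ∀ κ : ℝ, 0 < κ → κ ≤ c₀ → ∀ y : E4, τ₀ ≤ y 0 →
        (d.background p.1).radius y ≤ κ * y 0 → κ * y 0 < (d.background p.2).radius y := by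
    rintro ⟨i, j⟩
    by_cases hij : i = j
    · exact ⟨1, one_pos, 0, fun hne ↦ absurd hij hne⟩
    · obtain ⟨c₀, hc₀, τ₀, H⟩ := cone_pair (d.motion i).1 (d.motion j).1 (d.motion i).2
        (d.motion j).2 (d.spin i) (d.spin j) (horth i) (horth j) (hdv i j hij)
      exact ⟨c₀, hc₀, τ₀, fun _ ↦ H⟩
  choose c₀ hc₀ τ₀ hP using hpair
  obtain ⟨M, hM⟩ := Finite.exists_le fun p : Fin d.N × Fin d.N ↦ (c₀ p)⁻¹
  obtain ⟨T, hT⟩ := Finite.exists_le τ₀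
  refine ⟨(max M 1)⁻¹, by positivity, T, fun i j y hij hy hri ↦ ?_⟩
  have hc : (max M 1)⁻¹ ≤ c₀ (i, j) := by
    rw [inv_le_comm₀ (by positivity) (hc₀ _)]
    exact (hM (i, j)).trans (le_max_left _ _)
  exact hP (i, j) hij _ (by positivity) hc y ((hT (i, j)).trans hy) hri

end Summit.FinalStateConjecture.FinalStateConjecture.Theorems.NecksCertifyTwoCap.Cones

end
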